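import Summits.CriticalPhenomena.PercolationContinuityZ3.Theorems.PercNearOneGluingNoHeavyLowerTailSunflowerRelativeLemmaA
import HarnessLib

/-!
# `NoHeavyLowerTail` (crux stmt-CriticalPhenomena-4575), abstract sunflower cubic: THE LEAF-LEAF LEMMA IN THE `z₂`-PETAL CASE —
# Lemma A for the core `A ∪ [z₁u] ∪ [z₂w] ∪ [z₁z₂]` and every petal system one of whose petals contains `{z₂ open}`

Support file (seat `prim-ineq-prove-1` gen 66; `--supports stmt-CriticalPhenomena-4575`).  No `sorry`, no named facts, no new
definitions.  Memo: run/shared/lean/prim/prim-ineq-prove-1/FINDING-RLA-prove1-g66.md §3.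

SETTING (`…SunflowerLeafLeaf`, `…SunflowerRelativeLemmaA`).  The leaf-leaf conjecture `LeafLeafSafe` asks that the core
`A' = A ∪ [z₁u] ∪ [z₂w] ∪ [z₁z₂]` of `Γ + z₁z₂` (`z₁ ~ u`, `z₂ ~ w` leaves of `Γ`, `A` = the core of the rest) be A-safe when `A`
is.  Memo FINDING-COEFFWISE-prove1-g51.md §3, §8 (R2) reduced the `z₂`-SUBCASE — petal systems one of whose petals contains the
event `{z₂ open}` — to the relative Lemma A `RLA(A ∪ [z₁u], A ∪ [z₁u] ∪ [z₁] ∪ [w])` (= (RES0)), now the tree theorem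
`relLemmaA_pendant` (gen 66, from (RES0′) ∀n, gen 65).  This file performs that reduction at the set level.
* Analytic endgame (`LeafLeafZ.pair_merge`, `prod_merge_le`, `zTwo_endgame`): with `φ(x) = ta + (1−t)x`, `F = φ(g)`,
  `0 < g ≤ a`, petals `G_j ≥ g` merge ALIGNED: `∏_J φ(G_j) ≤ F^(|J|−1)·φ(∏_J G_j / g^(|J|−1))` (two petals:
  `F·φ(G₁G₂/g) − φ(G₁)φ(G₂) = ta(1−t)(G₁−g)(G₂−g)/g`); hence from (I1) `G₀·∏_J G_j ≤ g^|J|` and (I2) `∏_J G_j ≤ a·g^(|J|−1)`: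
  `(t + (1−t)G₀)·∏_J φ(G_j) ≤ F^|J|` (case `aG₀ ≥ g`: merge the `|J|+1` petals `aG₀, G_j` and use (I1); case `aG₀ < g`:
  `a(t + (1−t)G₀) ≤ F` and merge the `J`-petals, (I2)).  This is memo g51 §3 (Z) ⟸ (RES0) made exact, including the `z₂`-petal's
  own resources `G₀`.
* **`leafLeaf_zTwo`** (fixed `p`).  `A` an up-set not depending on `z₁, z₂`; `z₁, z₂, u, w` pairwise distinct; `delMinor u A`,
  `conMinor w A`, `conMinor u (conMinor w A)` and `A ∪ [z₁u]` safe at `p`; `μ(delMinor u A) > 0`.  Then for every family of up-sets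
  `V_0..V_{n−1}` meeting pairwise inside `A'` and containing a petal `V_{i₀} ⊇ {z₂ open}`:  `∏ μ(V_i) ≤ μ(A')^(n−1)`.
  PROOF.  Enlarge to `W_i = V_i ∪ A'`; condition on `z₂` (`t = p_{z₂}`): for `i ≠ i₀` the `z₂`-open section of `W_i` EQUALS
  `T := A ∪ [z₁u] ∪ [z₁] ∪ [w]` (it contains `T = (A')|_{z₂ open}` and `W_i ∩ [z₂] ⊆ W_i ∩ W_{i₀} ⊆ A'`), the `z₂`-closed sections
  `L_i` (`i ≤ n`) form a petal system of `C := A ∪ [z₁u] = (A')|_{z₂ closed}` with `L_i ⊆ T` for `i ≠ i₀`; so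
  `μ(W_i) = ta + (1−t)G_i` (`i ≠ i₀`), `μ(W_{i₀}) ≤ t + (1−t)G_{i₀}`, `μ(A') = ta + (1−t)g` with `a = μ(T)`, `g = μ(C)`,
  (I1) = `Safe p C`, (I2) = `relLemmaA_pendant`; conclude by `zTwo_endgame`.
* `leafLeaf_zTwo_aSafe`: the same from A-safety of `A` alone (+ positivity), the safety of `A ∪ [z₁u]` being the pendant theorem
  `Pendant.safe_union_pendant`.
* GRAPH FORM `leafLeaf_zTwo_graph`: `Γ₀` a graph with `z₁, z₂` isolated, `edgeCore Γ₀` A-safe; then for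
  `Γ' = Γ₀ + z₁u + z₂w + z₁z₂` every petal system of `edgeCore Γ'` with a petal containing `{z₂ open}` satisfies Lemma A at every
  `p` with `μ_p(delMinor u (edgeCore Γ₀)) > 0`.  (By the symmetry `z₁ ↔ z₂`, `u ↔ w` the same holds for petals containing `{z₁ open}`.)
What is NOT here: petal systems none of whose petals contains `[z₁]` or `[z₂]` (the general leaf-leaf lemma, open), and the
degenerate weights `μ(delMinor u A) = 0`.
-/

noncomputable section

namespace Summit.CriticalPhenomena.PercolationContinuityZ3.Theorems.SunflowerPartition

namespace SafeCalc

open MeasureTheory Finset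
open Literature.Probability.LatticeModels Literature.Probability.Percolation

variable {ι : Type*}

/-! ## The analytic endgame -/

namespace LeafLeafZ

variable {κ : Type*}

/-- Two aligned petals merge: `φ(G₁)φ(G₂) ≤ φ(g)·φ(G₁G₂/g)` for `φ(x) = ta + (1−t)x`, `G₁, G₂ ≥ g > 0`, `t ∈ [0,1]`, `a ≥ 0`
(the difference is `ta(1−t)(G₁−g)(G₂−g)/g`). [this work] -/
theorem pair_merge {t a g G₁ G₂ : ℝ} (ht0 : 0 ≤ t) (ht1 : t ≤ 1) (ha : 0 ≤ a) (hg : 0 < g) (h1 : g ≤ G₁) (h2 : g ≤ G₂) :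
    (t * a + (1 - t) * G₁) * (t * a + (1 - t) * G₂) ≤ (t * a + (1 - t) * g) * (t * a + (1 - t) * (G₁ * G₂ / g)) := by
  rw [← sub_nonneg]
  have key : (t * a + (1 - t) * g) * (t * a + (1 - t) * (G₁ * G₂ / g)) - (t * a + (1 - t) * G₁) * (t * a + (1 - t) * G₂)
      = t * a * (1 - t) * ((G₁ - g) * (G₂ - g) / g) := by
    field_simp
    ring
  rw [key]
  exact mul_nonneg (mul_nonneg (mul_nonneg ht0 ha) (sub_nonneg.2 ht1))
    (div_nonneg (mul_nonneg (sub_nonneg.2 h1) (sub_nonneg.2 h2)) hg.le)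

/-- The merged value of a family above the floor is above the floor: `g ≤ ∏_J G_j / g^(|J|−1)`. [this work] -/
theorem le_prod_div_pow {g : ℝ} (hg : 0 < g) (J : Finset κ) (hJ : J.Nonempty) (G : κ → ℝ) (hG : ∀ j ∈ J, g ≤ G j) :
    g ≤ (∏ j ∈ J, G j) / g ^ (J.card - 1) := by
  have hcard : J.card = J.card - 1 + 1 := (Nat.sub_add_cancel (card_pos.2 hJ)).symm
  rw [le_div_iff₀ (pow_pos hg _)]
  calc g * g ^ (J.card - 1) = g ^ J.card := by conv_rhs => rw [hcard, pow_succ]; ring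
    _ = ∏ _j ∈ J, g := (prod_const g).symm
    _ ≤ ∏ j ∈ J, G j := prod_le_prod (fun _ _ => hg.le) hG

/-- **Aligned merging of a whole family**: `∏_J φ(G_j) ≤ φ(g)^(|J|−1)·φ(∏_J G_j / g^(|J|−1))` (`J` nonempty, `G_j ≥ g > 0`).
[this work] -/
theorem prod_merge_le [DecidableEq κ] {t a g : ℝ} (ht0 : 0 ≤ t) (ht1 : t ≤ 1) (ha : 0 ≤ a) (hg : 0 < g) (J : Finset κ)
    (hJ : J.Nonempty) (G : κ → ℝ) (hG : ∀ j ∈ J, g ≤ G j) :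
    ∏ j ∈ J, (t * a + (1 - t) * G j) ≤
      (t * a + (1 - t) * g) ^ (J.card - 1) * (t * a + (1 - t) * ((∏ j ∈ J, G j) / g ^ (J.card - 1))) := by
  classical
  induction J using Finset.induction_on with
  | empty => exact absurd hJ (by simp)
  | @insert b J hb ih =>
    rcases J.eq_empty_or_nonempty with rfl | hJne
    · simp
    · have hG' : ∀ j ∈ J, g ≤ G j := fun j hj => hG j (mem_insert_of_mem hj)
      have hGb : g ≤ G b := hG b (mem_insert_self b J)
      have ih' := ih hJne hG'
      have hM : g ≤ (∏ j ∈ J, G j) / g ^ (J.card - 1) := le_prod_div_pow hg J hJne G hG'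
      have hφb : 0 ≤ t * a + (1 - t) * G b :=
        add_nonneg (mul_nonneg ht0 ha) (mul_nonneg (sub_nonneg.2 ht1) (hg.le.trans hGb))
      have hF : 0 ≤ t * a + (1 - t) * g := add_nonneg (mul_nonneg ht0 ha) (mul_nonneg (sub_nonneg.2 ht1) hg.le)
      have hcard : (insert b J).card - 1 = J.card := by rw [card_insert_of_notMem hb]; simp
      have hcard' : J.card = J.card - 1 + 1 := (Nat.sub_add_cancel (card_pos.2 hJne)).symm
      have hFpow : (t * a + (1 - t) * g) ^ J.card = (t * a + (1 - t) * g) ^ (J.card - 1) * (t * a + (1 - t) * g) := by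
        conv_lhs => rw [hcard', pow_succ]
      have hgpow : g ^ J.card = g ^ (J.card - 1) * g := by conv_lhs => rw [hcard', pow_succ]
      have hmerge : G b * ((∏ j ∈ J, G j) / g ^ (J.card - 1)) / g = (G b * ∏ j ∈ J, G j) / g ^ J.card := by
        have hgp : g ^ (J.card - 1) ≠ 0 := pow_ne_zero _ hg.ne'
        rw [hgpow]
        field_simp
      rw [prod_insert hb, prod_insert hb, hcard]
      calc (t * a + (1 - t) * G b) * ∏ j ∈ J, (t * a + (1 - t) * G j)
          ≤ (t * a + (1 - t) * G b) * ((t * a + (1 - t) * g) ^ (J.card - 1) *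
              (t * a + (1 - t) * ((∏ j ∈ J, G j) / g ^ (J.card - 1)))) := mul_le_mul_of_nonneg_left ih' hφb
        _ = (t * a + (1 - t) * g) ^ (J.card - 1) * ((t * a + (1 - t) * G b) *
              (t * a + (1 - t) * ((∏ j ∈ J, G j) / g ^ (J.card - 1)))) := by ring
        _ ≤ (t * a + (1 - t) * g) ^ (J.card - 1) * ((t * a + (1 - t) * g) *
              (t * a + (1 - t) * (G b * ((∏ j ∈ J, G j) / g ^ (J.card - 1)) / g))) :=
            mul_le_mul_of_nonneg_left (pair_merge ht0 ht1 ha hg hGb hM) (pow_nonneg hF _)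
        _ = (t * a + (1 - t) * g) ^ J.card * (t * a + (1 - t) * ((G b * ∏ j ∈ J, G j) / g ^ J.card)) := by
            rw [hmerge, hFpow]
            ring

/-- **The `z₂`-petal endgame.**  `t ∈ [0,1]`, `0 < g ≤ a`, petals `G_j ≥ g` (`j ∈ J`) and `G₀ ≥ 0` with
(I1) `G₀·∏_J G_j ≤ g^|J|` and (I2) `∏_J G_j ≤ a·g^(|J|−1)` (when `J ≠ ∅`).  Then
`(t + (1−t)G₀)·∏_J (ta + (1−t)G_j) ≤ (ta + (1−t)g)^|J|`. [this work] -/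
theorem zTwo_endgame [DecidableEq κ] {t a g G₀ : ℝ} (ht0 : 0 ≤ t) (ht1 : t ≤ 1) (hg : 0 < g) (hga : g ≤ a) (J : Finset κ)
    (G : κ → ℝ) (hG : ∀ j ∈ J, g ≤ G j) (hG₀ : 0 ≤ G₀) (hI1 : G₀ * ∏ j ∈ J, G j ≤ g ^ J.card)
    (hI2 : J.Nonempty → ∏ j ∈ J, G j ≤ a * g ^ (J.card - 1)) :
    (t + (1 - t) * G₀) * ∏ j ∈ J, (t * a + (1 - t) * G j) ≤ (t * a + (1 - t) * g) ^ J.card := by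
  classical
  have ha : 0 < a := hg.trans_le hga
  have ht' : 0 ≤ 1 - t := sub_nonneg.2 ht1
  have hF : 0 ≤ t * a + (1 - t) * g := add_nonneg (mul_nonneg ht0 ha.le) (mul_nonneg ht' hg.le)
  have hφ0 : 0 ≤ t + (1 - t) * G₀ := add_nonneg ht0 (mul_nonneg ht' hG₀)
  have hP0 : 0 ≤ ∏ j ∈ J, (t * a + (1 - t) * G j) :=
    prod_nonneg fun j hj => add_nonneg (mul_nonneg ht0 ha.le) (mul_nonneg ht' (hg.le.trans (hG j hj)))
  rcases J.eq_empty_or_nonempty with rfl | hJ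
  · -- no other petal: `G₀ ≤ 1`
    simp only [prod_empty, mul_one, card_empty, pow_zero] at hI1 ⊢
    nlinarith
  -- it suffices to bound `a ·` the left-hand side by `F^|J| · a`
  have hcard : J.card = J.card - 1 + 1 := (Nat.sub_add_cancel (card_pos.2 hJ)).symm
  have hFpow : (t * a + (1 - t) * g) ^ J.card = (t * a + (1 - t) * g) ^ (J.card - 1) * (t * a + (1 - t) * g) := by
    conv_lhs => rw [hcard, pow_succ]
  have hgpow : g ^ J.card = g ^ (J.card - 1) * g := by conv_lhs => rw [hcard, pow_succ]
  have hM := prod_merge_le ht0 ht1 ha.le hg J hJ G hG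
  suffices h : a * ((t + (1 - t) * G₀) * ∏ j ∈ J, (t * a + (1 - t) * G j)) ≤ (t * a + (1 - t) * g) ^ J.card * a by
    nlinarith [mul_nonneg hφ0 hP0, pow_nonneg hF J.card]
  by_cases hc : g ≤ a * G₀
  · -- case `aG₀ ≥ g`: merge all `|J| + 1` petals, then (I1)
    have hM0 : g ≤ (∏ j ∈ J, G j) / g ^ (J.card - 1) := le_prod_div_pow hg J hJ G hG
    have h2 := pair_merge ht0 ht1 ha.le hg hc hM0
    have hval : a * G₀ * ((∏ j ∈ J, G j) / g ^ (J.card - 1)) / g ≤ a := by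
      have hgp : 0 < g ^ (J.card - 1) := pow_pos hg _
      rw [div_le_iff₀ hg, mul_div_assoc', div_le_iff₀ hgp]
      calc a * G₀ * ∏ j ∈ J, G j = a * (G₀ * ∏ j ∈ J, G j) := by ring
        _ ≤ a * g ^ J.card := mul_le_mul_of_nonneg_left hI1 ha.le
        _ = a * g * g ^ (J.card - 1) := by rw [hgpow]; ring
    calc a * ((t + (1 - t) * G₀) * ∏ j ∈ J, (t * a + (1 - t) * G j))
        = (t * a + (1 - t) * (a * G₀)) * ∏ j ∈ J, (t * a + (1 - t) * G j) := by ring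
      _ ≤ (t * a + (1 - t) * (a * G₀)) * ((t * a + (1 - t) * g) ^ (J.card - 1) *
            (t * a + (1 - t) * ((∏ j ∈ J, G j) / g ^ (J.card - 1)))) :=
          mul_le_mul_of_nonneg_left hM (add_nonneg (mul_nonneg ht0 ha.le) (mul_nonneg ht' (hg.le.trans hc)))
      _ = (t * a + (1 - t) * g) ^ (J.card - 1) * ((t * a + (1 - t) * (a * G₀)) *
            (t * a + (1 - t) * ((∏ j ∈ J, G j) / g ^ (J.card - 1)))) := by ring
      _ ≤ (t * a + (1 - t) * g) ^ (J.card - 1) * ((t * a + (1 - t) * g) *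
            (t * a + (1 - t) * (a * G₀ * ((∏ j ∈ J, G j) / g ^ (J.card - 1)) / g))) :=
          mul_le_mul_of_nonneg_left h2 (pow_nonneg hF _)
      _ ≤ (t * a + (1 - t) * g) ^ (J.card - 1) * ((t * a + (1 - t) * g) * (t * a + (1 - t) * a)) := by
          refine mul_le_mul_of_nonneg_left (mul_le_mul_of_nonneg_left ?_ hF) (pow_nonneg hF _)
          have := mul_le_mul_of_nonneg_left hval ht'
          linarith
      _ = (t * a + (1 - t) * g) ^ J.card * a := by rw [hFpow]; ring
  · -- case `aG₀ < g`: the `z₂`-petal alone is below `F/a`, the others merge and use (I2)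
    push Not at hc
    have h0 : a * (t + (1 - t) * G₀) ≤ t * a + (1 - t) * g := by nlinarith [mul_le_mul_of_nonneg_left hc.le ht']
    have hval : (∏ j ∈ J, G j) / g ^ (J.card - 1) ≤ a := by
      rw [div_le_iff₀ (pow_pos hg _)]; exact hI2 hJ
    calc a * ((t + (1 - t) * G₀) * ∏ j ∈ J, (t * a + (1 - t) * G j))
        = (a * (t + (1 - t) * G₀)) * ∏ j ∈ J, (t * a + (1 - t) * G j) := by ring
      _ ≤ (t * a + (1 - t) * g) * ((t * a + (1 - t) * g) ^ (J.card - 1) *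
            (t * a + (1 - t) * ((∏ j ∈ J, G j) / g ^ (J.card - 1)))) := mul_le_mul h0 hM hP0 hF
      _ ≤ (t * a + (1 - t) * g) * ((t * a + (1 - t) * g) ^ (J.card - 1) * (t * a + (1 - t) * a)) := by
          refine mul_le_mul_of_nonneg_left (mul_le_mul_of_nonneg_left ?_ (pow_nonneg hF _)) hF
          have := mul_le_mul_of_nonneg_left hval ht'
          linarith
      _ = (t * a + (1 - t) * g) ^ J.card * a := by rw [hFpow]; ring

end LeafLeafZ

/-! ## More one-coordinate sections -/

namespace RelLemmaA

open UnionEdge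

/-- The open section of `{u, z open}` at `z` is `{u open}`. [this work] -/
theorem secOn_pairOpen_right {z u : ι} (hne : u ≠ z) : secOn z (pairOpen u z) = {ω | u ∈ ω} := by
  ext ω
  simp only [secOn, pairOpen, Set.mem_setOf_eq, Set.mem_insert_iff, true_or, and_true]
  exact ⟨fun h => h.resolve_left hne, fun h => Or.inr h⟩

/-- The closed section of `{u, z open}` at `z` is empty. [this work] -/
theorem secOff_pairOpen_right (z u : ι) : secOff z (pairOpen u z) = ∅ := by
  ext ω
  simp [secOff, pairOpen]

/-- The open section of `{a, b open}` at a third coordinate is `{a, b open}`. [this work] -/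
theorem secOn_pairOpen_of_ne {z a b : ι} (ha : a ≠ z) (hb : b ≠ z) : secOn z (pairOpen a b) = pairOpen a b := by
  ext ω
  simp [secOn, pairOpen, ha, hb]

/-- The closed section of `{a, b open}` at a third coordinate is `{a, b open}`. [this work] -/
theorem secOff_pairOpen_of_ne {z a b : ι} (ha : a ≠ z) (hb : b ≠ z) : secOff z (pairOpen a b) = pairOpen a b := by
  ext ω
  simp [secOff, pairOpen, ha, hb]

/-- `pairOpen` is symmetric. [this work] -/
theorem pairOpen_comm (a b : ι) : pairOpen a b = pairOpen b a := by
  ext ω; exact And.comm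

end RelLemmaA

open RelLemmaA UnionEdge

variable [Fintype ι] [DecidableEq ι] (p : ι → unitInterval)

/-- `relLemmaA_pendant` for families indexed by an arbitrary nonempty finite type. [this work] -/
theorem relLemmaA_pendant_fintype {z₁ u w : ι} (hzu : z₁ ≠ u) (hzw : z₁ ≠ w) (huw : u ≠ w) {A : Set (Set ι)}
    (hd : DeterminedBy A (↑({z₁} : Finset ι) : Set ι)ᶜ) (hA : IsUpperSet A)
    (hA0 : Safe p (delMinor u A)) (hA1 : Safe p (conMinor w A)) (hA11 : Safe p (conMinor u (conMinor w A)))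
    (hpos : 0 < (prodBernoulli p).real (delMinor u A))
    {κ : Type*} [Fintype κ] (hκ : 0 < Fintype.card κ) (V : κ → Set (Set ι)) (hV : ∀ i, IsUpperSet (V i))
    (hcap : ∀ i j, i ≠ j → V i ∩ V j ⊆ A ∪ pairOpen z₁ u)
    (hT : ∀ i, V i ⊆ A ∪ pairOpen z₁ u ∪ ({ω | z₁ ∈ ω} ∪ {ω | w ∈ ω})) :
    ∏ i, (prodBernoulli p).real (V i) ≤
      (prodBernoulli p).real (A ∪ pairOpen z₁ u ∪ ({ω | z₁ ∈ ω} ∪ {ω | w ∈ ω})) *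
        (prodBernoulli p).real (A ∪ pairOpen z₁ u) ^ (Fintype.card κ - 1) := by
  classical
  let e := Fintype.equivFin κ
  have h := relLemmaA_pendant p hzu hzw huw hd hA hA0 hA1 hA11 hpos hκ (fun k => V (e.symm k)) (fun k => hV _)
    (fun k l hkl => hcap _ _ fun h => hkl (e.symm.injective h)) (fun k => hT _)
  rwa [Fintype.prod_equiv e.symm (fun k => (prodBernoulli p).real (V (e.symm k)))
    (fun i => (prodBernoulli p).real (V i)) (fun k => rfl)] at h

/-- **THE LEAF-LEAF LEMMA, `z₂`-PETAL CASE (fixed `p`).**  `A` an up-set not depending on `z₁` nor on `z₂`; `z₁, z₂, u, w`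
pairwise distinct; `delMinor u A`, `conMinor w A`, `conMinor u (conMinor w A)` and `A ∪ {z₁,u open}` safe at `p`;
`μ(delMinor u A) > 0`.  Put `A' = A ∪ {z₁,u open} ∪ ({z₁,z₂ open} ∪ {z₂,w open})` (the core of `Γ + z₁z₂` for leaves `z₁ ~ u`,
`z₂ ~ w`).  Then every family of up-sets `V_i` meeting pairwise inside `A'`, one of which contains `{z₂ open}`, satisfies
`∏ μ(V_i) ≤ μ(A')^(n−1)`. [this work] -/
theorem leafLeaf_zTwo {z₁ z₂ u w : ι} (h12 : z₁ ≠ z₂) (h1u : z₁ ≠ u) (h1w : z₁ ≠ w) (h2u : z₂ ≠ u) (h2w : z₂ ≠ w)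
    (huw : u ≠ w) {A : Set (Set ι)} (hd₁ : DeterminedBy A (↑({z₁} : Finset ι) : Set ι)ᶜ)
    (hd₂ : DeterminedBy A (↑({z₂} : Finset ι) : Set ι)ᶜ) (hA : IsUpperSet A)
    (hA0 : Safe p (delMinor u A)) (hA1 : Safe p (conMinor w A)) (hA11 : Safe p (conMinor u (conMinor w A)))
    (hC : Safe p (A ∪ pairOpen z₁ u)) (hpos : 0 < (prodBernoulli p).real (delMinor u A))
    {n : ℕ} (V : Fin n → Set (Set ι)) (hV : ∀ i, IsUpperSet (V i))
    (hcap : ∀ i j, i ≠ j → V i ∩ V j ⊆ A ∪ pairOpen z₁ u ∪ (pairOpen z₁ z₂ ∪ pairOpen z₂ w))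
    (i₀ : Fin n) (hz : {ω | z₂ ∈ ω} ⊆ V i₀) :
    ∏ i, (prodBernoulli p).real (V i) ≤
      (prodBernoulli p).real (A ∪ pairOpen z₁ u ∪ (pairOpen z₁ z₂ ∪ pairOpen z₂ w)) ^ (n - 1) := by
  classical
  set C : Set (Set ι) := A ∪ pairOpen z₁ u with hCdef
  set T : Set (Set ι) := A ∪ pairOpen z₁ u ∪ ({ω | z₁ ∈ ω} ∪ {ω | w ∈ ω}) with hTdef
  set A' : Set (Set ι) := A ∪ pairOpen z₁ u ∪ (pairOpen z₁ z₂ ∪ pairOpen z₂ w) with hA'def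
  have hCup : IsUpperSet C := hA.union (isUpperSet_pairOpen z₁ u)
  have hA'up : IsUpperSet A' := hCup.union ((isUpperSet_pairOpen z₁ z₂).union (isUpperSet_pairOpen z₂ w))
  -- sections of `A'` at `z₂`
  have hA'_on : secOn z₂ A' = T := by
    rw [hA'def, secOn_union, secOn_union, secOn_union, secOn_eq_self_of_determinedBy hd₂, secOn_pairOpen_of_ne h12 h2u.symm,
      secOn_pairOpen_right h12, secOn_pairOpen_left h2w]
  have hA'_off : secOff z₂ A' = C := by
    rw [hA'def, secOff_union, secOff_union, secOff_union, secOff_eq_self_of_determinedBy hd₂,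
      secOff_pairOpen_of_ne h12 h2u.symm, secOff_pairOpen_right, secOff_pairOpen_left, Set.union_empty, Set.union_empty]
  -- enlarge the petals
  set W : Fin n → Set (Set ι) := fun i => V i ∪ A' with hW
  have hWup : ∀ i, IsUpperSet (W i) := fun i => (hV i).union hA'up
  have hWA : ∀ i, A' ⊆ W i := fun i => Set.subset_union_right
  have hWcap : ∀ i j, i ≠ j → W i ∩ W j ⊆ A' := by
    intro i j hij ω hω
    rcases hω with ⟨h1 | h1, h2 | h2⟩
    · exact hcap i j hij ⟨h1, h2⟩
    exacts [h2, h1, h1]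
  have hmono : ∀ i, (prodBernoulli p).real (V i) ≤ (prodBernoulli p).real (W i) :=
    fun i => measureReal_mono Set.subset_union_left
  have hz' : {ω | z₂ ∈ ω} ⊆ W i₀ := hz.trans Set.subset_union_left
  -- the `z₂`-sections of the petals
  have hU : ∀ i, i ≠ i₀ → secOn z₂ (W i) = T := by
    intro i hi
    refine le_antisymm (fun ω hω => ?_) (hA'_on ▸ secOn_mono z₂ (hWA i))
    have h1 : insert z₂ ω ∈ W i ∩ W i₀ := ⟨hω, hz' (Set.mem_insert z₂ ω)⟩
    have h2 : ω ∈ secOn z₂ A' := hWcap i i₀ hi h1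
    rwa [hA'_on] at h2
  set L : Fin n → Set (Set ι) := fun i => secOff z₂ (W i) with hL
  have hLup : ∀ i, IsUpperSet (L i) := fun i => isUpperSet_secOff z₂ (hWup i)
  have hLC : ∀ i, C ⊆ L i := fun i => hA'_off ▸ secOff_mono z₂ (hWA i)
  have hLcap : ∀ i j, i ≠ j → L i ∩ L j ⊆ C := fun i j hij => by
    simp only [hL]; rw [← secOff_inter, ← hA'_off]; exact secOff_mono z₂ (hWcap i j hij)
  have hLT : ∀ i, i ≠ i₀ → L i ⊆ T := fun i hi => (hU i hi) ▸ secOff_subset_secOn z₂ (hWup i)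
  -- numbers
  set t : ℝ := ((p z₂ : unitInterval) : ℝ) with ht
  have ht0 : 0 ≤ t := (p z₂).2.1
  have ht1 : t ≤ 1 := (p z₂).2.2
  set g : ℝ := (prodBernoulli p).real C with hgdef
  set a : ℝ := (prodBernoulli p).real T with hadef
  set G : Fin n → ℝ := fun i => (prodBernoulli p).real (L i) with hGdef
  have hga : g ≤ a := measureReal_mono Set.subset_union_left
  have hgpos : 0 < g := by
    refine hpos.trans_le (measureReal_mono ?_)
    exact (delMinor_subset u hA).trans Set.subset_union_left
  have hGg : ∀ i ∈ univ.erase i₀, g ≤ G i := fun i _ => measureReal_mono (hLC i)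
  have hG0 : 0 ≤ G i₀ := measureReal_nonneg
  have hA'val : (prodBernoulli p).real A' = t * a + (1 - t) * g := by
    rw [real_eq_secOn_secOff p z₂ A', hA'_on, hA'_off]
  have hWval : ∀ i, i ≠ i₀ → (prodBernoulli p).real (W i) = t * a + (1 - t) * G i := by
    intro i hi; rw [real_eq_secOn_secOff p z₂ (W i), hU i hi]
  have hW₀ : (prodBernoulli p).real (W i₀) ≤ t + (1 - t) * G i₀ := by
    rw [real_eq_secOn_secOff p z₂ (W i₀)]
    have h1 : (prodBernoulli p).real (secOn z₂ (W i₀)) ≤ 1 := measureReal_le_one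
    nlinarith [mul_le_mul_of_nonneg_left h1 ht0]
  -- (I1): `Safe p C` on the `z₂`-closed sections
  have hI1 : G i₀ * ∏ j ∈ univ.erase i₀, G j ≤ g ^ (univ.erase i₀).card := by
    have h := hC n L hLup hLcap
    rw [← mul_prod_erase univ (fun i => (prodBernoulli p).real (L i)) (mem_univ i₀)] at h
    rw [card_erase_of_mem (mem_univ i₀), card_univ, Fintype.card_fin]
    exact h
  -- (I2): the relative Lemma A on the other petals
  have hI2 : (univ.erase i₀).Nonempty → ∏ j ∈ univ.erase i₀, G j ≤ a * g ^ ((univ.erase i₀).card - 1) := by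
    intro hne
    have hcard : Fintype.card {i : Fin n // i ≠ i₀} = (univ.erase i₀).card := by
      rw [Fintype.card_subtype]; congr 1; ext i; simp
    have hκ : 0 < Fintype.card {i : Fin n // i ≠ i₀} := by rw [hcard]; exact card_pos.2 hne
    have h := relLemmaA_pendant_fintype p h1u h1w huw hd₁ hA hA0 hA1 hA11 hpos hκ (fun i : {i : Fin n // i ≠ i₀} => L i)
      (fun i => hLup i) (fun i j hij => hLcap i j fun h => hij (Subtype.ext h)) (fun i => hLT i i.2)
    rw [hcard] at h
    rw [prod_subtype (univ.erase i₀) (p := fun i : Fin n => i ≠ i₀) (fun i => by simp)]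
    exact h
  -- assemble
  have key := LeafLeafZ.zTwo_endgame ht0 ht1 hgpos hga (univ.erase i₀) G hGg hG0 hI1 hI2
  rw [card_erase_of_mem (mem_univ i₀), card_univ, Fintype.card_fin] at key
  rw [hA'val]
  have hP0 : 0 ≤ ∏ j ∈ univ.erase i₀, (prodBernoulli p).real (W j) := prod_nonneg fun _ _ => measureReal_nonneg
  calc ∏ i, (prodBernoulli p).real (V i) ≤ ∏ i, (prodBernoulli p).real (W i) :=
        prod_le_prod (fun i _ => measureReal_nonneg) fun i _ => hmono i
    _ = (prodBernoulli p).real (W i₀) * ∏ j ∈ univ.erase i₀, (prodBernoulli p).real (W j) :=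
        (mul_prod_erase univ (fun i => (prodBernoulli p).real (W i)) (mem_univ i₀)).symm
    _ ≤ (t + (1 - t) * G i₀) * ∏ j ∈ univ.erase i₀, (prodBernoulli p).real (W j) :=
        mul_le_mul_of_nonneg_right hW₀ hP0
    _ = (t + (1 - t) * G i₀) * ∏ j ∈ univ.erase i₀, (t * a + (1 - t) * G j) := by
        congr 1; exact prod_congr rfl fun j hj => hWval j (ne_of_mem_erase hj)
    _ ≤ (t * a + (1 - t) * g) ^ (n - 1) := key

/-- **The leaf-leaf lemma, `z₂`-petal case, from A-safety of `A`** (+ positivity `μ_p(delMinor u A) > 0`): the safety of the minors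
is `aSafe_delMinor`/`aSafe_conMinor`, that of `A ∪ {z₁,u open}` is the pendant theorem `Pendant.safe_union_pendant`. [this work] -/
theorem leafLeaf_zTwo_aSafe {z₁ z₂ u w : ι} (h12 : z₁ ≠ z₂) (h1u : z₁ ≠ u) (h1w : z₁ ≠ w) (h2u : z₂ ≠ u) (h2w : z₂ ≠ w)
    (huw : u ≠ w) {A : Set (Set ι)} (hd₁ : DeterminedBy A (↑({z₁} : Finset ι) : Set ι)ᶜ)
    (hd₂ : DeterminedBy A (↑({z₂} : Finset ι) : Set ι)ᶜ) (hA : IsUpperSet A) (hsafe : ∀ q, Safe q A)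
    (hpos : 0 < (prodBernoulli p).real (delMinor u A))
    {n : ℕ} (V : Fin n → Set (Set ι)) (hV : ∀ i, IsUpperSet (V i))
    (hcap : ∀ i j, i ≠ j → V i ∩ V j ⊆ A ∪ pairOpen z₁ u ∪ (pairOpen z₁ z₂ ∪ pairOpen z₂ w))
    (i₀ : Fin n) (hz : {ω | z₂ ∈ ω} ⊆ V i₀) :
    ∏ i, (prodBernoulli p).real (V i) ≤
      (prodBernoulli p).real (A ∪ pairOpen z₁ u ∪ (pairOpen z₁ z₂ ∪ pairOpen z₂ w)) ^ (n - 1) := by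
  have hC : Safe p (A ∪ pairOpen z₁ u) := by
    rw [pairOpen_comm]
    exact Pendant.safe_union_pendant p h1u.symm hd₁ hA (hsafe p) (aSafe_delMinor hA hsafe u p) (aSafe_conMinor hA hsafe u p)
  exact leafLeaf_zTwo p h12 h1u h1w h2u h2w huw hd₁ hd₂ hA (aSafe_delMinor hA hsafe u p) (aSafe_conMinor hA hsafe w p)
    (aSafe_conMinor (isUpperSet_secOn w hA) (fun q => aSafe_conMinor hA hsafe w q) u p) hC hpos V hV hcap i₀ hz

/-! ## Graph form -/

/-- **Graph form.**  Let `z₁, z₂` be isolated in `Γ₀`, `z₁, z₂, u, w` pairwise distinct, `edgeCore Γ₀` A-safe.  For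
`Γ' = Γ₀ + z₁u + z₂w + z₁z₂` (so `z₁ ~ u`, `z₂ ~ w` are leaves of `Γ₀ + z₁u + z₂w` joined by the new edge) and every `p` with
`μ_p(delMinor u (edgeCore Γ₀)) > 0`: every family of up-sets meeting pairwise inside `edgeCore Γ'`, one of which contains
`{z₂ open}`, satisfies Lemma A `∏ μ(V_i) ≤ μ(edgeCore Γ')^(n−1)`. [this work] -/
theorem leafLeaf_zTwo_graph (Γ₀ : SimpleGraph ι) {z₁ z₂ u w : ι} (h12 : z₁ ≠ z₂) (h1u : z₁ ≠ u) (h1w : z₁ ≠ w)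
    (h2u : z₂ ≠ u) (h2w : z₂ ≠ w) (huw : u ≠ w) (hz₁ : ∀ x, ¬ Γ₀.Adj z₁ x) (hz₂ : ∀ x, ¬ Γ₀.Adj z₂ x)
    (hsafe : ∀ q : ι → unitInterval, Safe q (edgeCore Γ₀)) (hpos : 0 < (prodBernoulli p).real (delMinor u (edgeCore Γ₀)))
    {n : ℕ} (V : Fin n → Set (Set ι)) (hV : ∀ i, IsUpperSet (V i))
    (hcap : ∀ i j, i ≠ j → V i ∩ V j ⊆ edgeCore (Γ₀ ⊔ SimpleGraph.fromEdgeSet {s(z₁, u)} ⊔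
      SimpleGraph.fromEdgeSet {s(z₂, w)} ⊔ SimpleGraph.fromEdgeSet {s(z₁, z₂)}))
    (i₀ : Fin n) (hz : {ω | z₂ ∈ ω} ⊆ V i₀) :
    ∏ i, (prodBernoulli p).real (V i) ≤
      (prodBernoulli p).real (edgeCore (Γ₀ ⊔ SimpleGraph.fromEdgeSet {s(z₁, u)} ⊔ SimpleGraph.fromEdgeSet {s(z₂, w)} ⊔
        SimpleGraph.fromEdgeSet {s(z₁, z₂)})) ^ (n - 1) := by
  classical
  have hcore : edgeCore (Γ₀ ⊔ SimpleGraph.fromEdgeSet {s(z₁, u)} ⊔ SimpleGraph.fromEdgeSet {s(z₂, w)} ⊔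
      SimpleGraph.fromEdgeSet {s(z₁, z₂)}) = edgeCore Γ₀ ∪ pairOpen z₁ u ∪ (pairOpen z₁ z₂ ∪ pairOpen z₂ w) := by
    rw [edgeCore_sup_edge _ h12, edgeCore_sup_edge _ h2w, edgeCore_sup_edge _ h1u, Set.union_assoc _ (pairOpen z₂ w),
      Set.union_comm (pairOpen z₂ w)]
  rw [hcore] at hcap ⊢
  exact leafLeaf_zTwo_aSafe p h12 h1u h1w h2u h2w huw (determinedBy_edgeCore_of_isolated_one Γ₀ hz₁)
    (determinedBy_edgeCore_of_isolated_one Γ₀ hz₂) (isUpperSet_edgeCore Γ₀) hsafe hpos V hV hcap i₀ hz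

end SafeCalc

end Summit.CriticalPhenomena.PercolationContinuityZ3.Theorems.SunflowerPartition
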